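import Mathlib
import HarnessLib
import Literature.MathematicalPhysics.QuantumLattice.DWaveSourceProofs
import Literature.MathematicalPhysics.QuantumLattice.PairFieldMomentum
import Literature.MathematicalPhysics.QuantumLattice.ApproximateEigenvectorLemmas

/-!
# Crux `WcbcsBcsConstruction`, line `lro-seed-kink-bridge`: the abstract Koma–Tasaki trial state

Support file (`--supports stmt-HubbardSuperconductivity-2010`, registered sub-goal
`stub_wcbcsTrialStateAbstract`) for the stub `stub_trialStateBound` of the line
`lro-seed-kink-bridge` (`WeakCouplingBCSWcbcsBcsConstructionTrialStateBound.lean`). Pure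
finite-dimensional matrix analysis for Hermitian matrices `H` (Hamiltonian), `O` (order operator),
`N` (particle number) acting on `m → ℂ` by `mulVec`; inner product `⟨u, v⟩ = star u ⬝ᵥ v`,
Euclidean norm `eucNorm`, operator norm the `L2Operator` (C⋆) norm.

* Selection rules: eigenvectors of a Hermitian `N` with distinct real eigenvalues are orthogonal,
  `[N, X] = cX` shifts eigenvalues by `c`; hence for `O = X + Xᴴ` with `[N, X] = -2X` and an
  `N`-eigenvector `v`: `⟨v, Ov⟩ = 0`, `⟨Hv, Ov⟩ = 0` when `[N, H] = 0`, and `⟨Ov, O(Ov)⟩ = 0`.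
* The variational principle for an unnormalised trial vector, the Gram factorisation
  `H - E₀ = BᴴB` (`CStarAlgebra.nonneg_iff_eq_star_mul_self`) with the cross-term bound
  `Re⟨χ, HΨ⟩ ≤ E₀ Re⟨χ, Ψ⟩ + √(2‖H‖) ‖χ‖ √e`, and the identity `2OHO = O²H + HO² - [O,[O,H]]`.
* `stub_wcbcsTrialStateAbstract`: the abstract Koma–Tasaki trial-state bound (J. Stat. Phys.
  76 (1994) 745, proof of Theorem 2.2): for a unit vector `Ψ` obeying the three selection rules
  and `‖OΨ‖ ≥ s > 0`, the vector `Ξ = Ψ + OΨ/‖OΨ‖` gives, for `h ≥ 0`,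
  `E₀(H - hO) ≤ E₀(H) + e/2 + √(2‖H‖)‖O‖√e/(2s) + ‖[O,[O,H]]‖/(4s²) - hs`, `e` the excess
  energy `Re⟨Ψ, HΨ⟩ - E₀(H)` of `Ψ`.

No definitions; everything is proved.
-/

set_option linter.dupNamespace false

namespace Summit.HubbardSuperconductivity.HubbardSuperconductivity.Theorems

open Literature.MathematicalPhysics.QuantumLattice Literature.Probability.LatticeModels Matrix Filter
open scoped Matrix.Norms.L2Operator ComplexOrder Topology

namespace WcbcsTrialState

variable {m : Type*} [Fintype m]

/-! ### Selection rules from a conserved charge -/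

/-- Moving a Hermitian matrix across the inner product: `⟨u, M v⟩ = ⟨M u, v⟩`. [folklore] -/
theorem star_dotProduct_mulVec_of_isHermitian {M : Matrix m m ℂ} (hM : M.IsHermitian)
    (u v : m → ℂ) : star u ⬝ᵥ (M *ᵥ v) = star (M *ᵥ u) ⬝ᵥ v := by
  rw [star_mulVec, hM.eq, ← dotProduct_mulVec]

/-- Selection rule: eigenvectors of a Hermitian matrix with distinct real eigenvalues are
orthogonal. [folklore] -/
theorem star_dotProduct_eq_zero_of_eigen {N : Matrix m m ℂ} (hN : N.IsHermitian)
    {v w : m → ℂ} {a b : ℝ} (hv : N *ᵥ v = (a : ℂ) • v) (hw : N *ᵥ w = (b : ℂ) • w)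
    (hab : a ≠ b) : star v ⬝ᵥ w = 0 := by
  have h1 : star v ⬝ᵥ (N *ᵥ w) = (b : ℂ) * (star v ⬝ᵥ w) := by
    rw [hw, dotProduct_smul, smul_eq_mul]
  have h2 : star v ⬝ᵥ (N *ᵥ w) = (a : ℂ) * (star v ⬝ᵥ w) := by
    rw [star_dotProduct_mulVec_of_isHermitian hN, hv, star_smul, smul_dotProduct, smul_eq_mul,
      Complex.star_def, Complex.conj_ofReal]
  have h3 : ((a : ℂ) - b) * (star v ⬝ᵥ w) = 0 := by rw [sub_mul, ← h1, ← h2, sub_self]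
  have hne : (a : ℂ) - b ≠ 0 := by
    rw [sub_ne_zero]
    exact_mod_cast hab
  exact (mul_eq_zero.1 h3).resolve_left hne

/-- Charge shift: if `[N, X] = c X` and `N v = a v` then `N (X v) = (a + c) X v`. [folklore] -/
theorem eigen_mulVec_of_commutator {N X : Matrix m m ℂ} {c a : ℝ}
    (hX : N * X - X * N = (c : ℂ) • X) {v : m → ℂ} (hv : N *ᵥ v = (a : ℂ) • v) :
    N *ᵥ (X *ᵥ v) = ((a + c : ℝ) : ℂ) • (X *ᵥ v) := by
  have hNX : N * X = X * N + (c : ℂ) • X := by rw [← hX]; abel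
  rw [mulVec_mulVec, hNX, add_mulVec, smul_mulVec, ← mulVec_mulVec, hv, mulVec_smul,
    Complex.ofReal_add, add_smul]

/-- The adjoint carries the opposite charge: `[N, X] = c X` with `N` Hermitian and `c` real
gives `[N, Xᴴ] = -c Xᴴ`. [folklore] -/
theorem commutator_conjTranspose_of_commutator {N X : Matrix m m ℂ} (hN : N.IsHermitian)
    {c : ℝ} (hX : N * X - X * N = (c : ℂ) • X) :
    N * Xᴴ - Xᴴ * N = ((-c : ℝ) : ℂ) • Xᴴ := by
  have h := congrArg conjTranspose hX
  rw [conjTranspose_sub, conjTranspose_mul, conjTranspose_mul, conjTranspose_smul, hN.eq,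
    Complex.star_def, Complex.conj_ofReal] at h
  rw [Complex.ofReal_neg, neg_smul, ← h, neg_sub]

/-- No diagonal matrix element for a charged operator: if `N` is Hermitian, `[N, X] = -2X` and
`N v = a v` (`a` real) then `⟨v, (X + Xᴴ) v⟩ = 0`. [folklore] -/
theorem star_dotProduct_charged_mulVec_eq_zero {N X : Matrix m m ℂ} (hN : N.IsHermitian)
    (hX : N * X - X * N = ((-2 : ℝ) : ℂ) • X) {v : m → ℂ} {a : ℝ}
    (hv : N *ᵥ v = (a : ℂ) • v) : star v ⬝ᵥ ((X + Xᴴ) *ᵥ v) = 0 := by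
  have hX' := commutator_conjTranspose_of_commutator hN hX
  rw [add_mulVec, dotProduct_add,
    star_dotProduct_eq_zero_of_eigen hN hv (eigen_mulVec_of_commutator hX hv) (by linarith),
    star_dotProduct_eq_zero_of_eigen hN hv (eigen_mulVec_of_commutator hX' hv) (by linarith),
    add_zero]

/-- No matrix element of a charged operator between a sector and its image under a conserved
`H`: `⟨H v, (X + Xᴴ) v⟩ = 0` when `[N, H] = 0`, `[N, X] = -2X`, `N v = a v`. [folklore] -/
theorem star_mulVec_dotProduct_charged_mulVec_eq_zero {N X H : Matrix m m ℂ}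
    (hN : N.IsHermitian) (hX : N * X - X * N = ((-2 : ℝ) : ℂ) • X)
    (hH : N * H - H * N = ((0 : ℝ) : ℂ) • H) {v : m → ℂ} {a : ℝ} (hv : N *ᵥ v = (a : ℂ) • v) :
    star (H *ᵥ v) ⬝ᵥ ((X + Xᴴ) *ᵥ v) = 0 := by
  have hX' := commutator_conjTranspose_of_commutator hN hX
  have hHv := eigen_mulVec_of_commutator hH hv
  rw [add_mulVec, dotProduct_add,
    star_dotProduct_eq_zero_of_eigen hN hHv (eigen_mulVec_of_commutator hX hv) (by linarith),
    star_dotProduct_eq_zero_of_eigen hN hHv (eigen_mulVec_of_commutator hX' hv) (by linarith),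
    add_zero]

/-- The cubic selection rule: with `O = X + Xᴴ`, `[N, X] = -2X`, `N v = a v`,
`⟨O v, O (O v)⟩ = 0` (`O v` lives in charges `a ± 2`, `O (O v)` in `a, a ± 4`). [folklore] -/
theorem star_charged_mulVec_dotProduct_eq_zero {N X : Matrix m m ℂ} (hN : N.IsHermitian)
    (hX : N * X - X * N = ((-2 : ℝ) : ℂ) • X) {v : m → ℂ} {a : ℝ}
    (hv : N *ᵥ v = (a : ℂ) • v) :
    star ((X + Xᴴ) *ᵥ v) ⬝ᵥ ((X + Xᴴ) *ᵥ ((X + Xᴴ) *ᵥ v)) = 0 := by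
  have hX' := commutator_conjTranspose_of_commutator hN hX
  have hm := eigen_mulVec_of_commutator hX hv
  have hp := eigen_mulVec_of_commutator hX' hv
  have h1 := star_dotProduct_charged_mulVec_eq_zero hN hX hm
  have h2 := star_dotProduct_charged_mulVec_eq_zero hN hX hp
  have h3 := star_dotProduct_eq_zero_of_eigen hN hm (eigen_mulVec_of_commutator hX hp)
    (by linarith)
  have h4 := star_dotProduct_eq_zero_of_eigen hN hm (eigen_mulVec_of_commutator hX' hp)
    (by linarith)
  have h5 := star_dotProduct_eq_zero_of_eigen hN hp (eigen_mulVec_of_commutator hX hm)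
    (by linarith)
  have h6 := star_dotProduct_eq_zero_of_eigen hN hp (eigen_mulVec_of_commutator hX' hm)
    (by linarith)
  have hsplit : (X + Xᴴ) *ᵥ v = X *ᵥ v + Xᴴ *ᵥ v := add_mulVec _ _ _
  rw [hsplit, mulVec_add (X + Xᴴ) (X *ᵥ v) (Xᴴ *ᵥ v), star_add, add_dotProduct, dotProduct_add,
    dotProduct_add, h1, h2, add_mulVec, add_mulVec, dotProduct_add, dotProduct_add, h3, h4, h5, h6]
  simp

/-! ### Quadratic forms, the variational principle and the Gram form of `H - E₀` -/

/-- Expansion of a quadratic form on `Ψ + c Φ` (`c` real):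
`⟨Ψ + cΦ, M(Ψ + cΦ)⟩ = ⟨Ψ,MΨ⟩ + c⟨Ψ,MΦ⟩ + c⟨Φ,MΨ⟩ + c²⟨Φ,MΦ⟩`. [folklore] -/
theorem star_dotProduct_mulVec_add_smul (M : Matrix m m ℂ) (Ψ Φ : m → ℂ) (c : ℝ) :
    star (Ψ + (c : ℂ) • Φ) ⬝ᵥ (M *ᵥ (Ψ + (c : ℂ) • Φ)) =
      star Ψ ⬝ᵥ (M *ᵥ Ψ) + (c : ℂ) * (star Ψ ⬝ᵥ (M *ᵥ Φ)) + (c : ℂ) * (star Φ ⬝ᵥ (M *ᵥ Ψ)) +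
        (c : ℂ) ^ 2 * (star Φ ⬝ᵥ (M *ᵥ Φ)) := by
  rw [mulVec_add, mulVec_smul, star_add, star_smul, add_dotProduct, dotProduct_add,
    dotProduct_add, smul_dotProduct, smul_dotProduct, dotProduct_smul, dotProduct_smul,
    Complex.star_def, Complex.conj_ofReal]
  simp only [smul_eq_mul]
  ring

variable [DecidableEq m]

/-- Variational principle for an unnormalised trial vector: `E₀(K) · ‖Ξ‖² ≤ Re ⟨Ξ, K Ξ⟩`.
[folklore] -/
theorem groundEnergy_mul_le_re {K : Matrix m m ℂ} (hK : K.IsHermitian) (Ξ : m → ℂ) :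
    K.groundEnergy * (star Ξ ⬝ᵥ Ξ).re ≤ (star Ξ ⬝ᵥ (K *ᵥ Ξ)).re := by
  have h := (posSemidef_sub_groundEnergy hK).re_dotProduct_nonneg Ξ
  rw [sub_mulVec, dotProduct_sub, Algebra.algebraMap_eq_smul_one, smul_mulVec, one_mulVec,
    dotProduct_smul] at h
  rw [RCLike.re_to_complex, Complex.sub_re, Complex.real_smul, Complex.re_ofReal_mul] at h
  linarith

/-- `Re ⟨u, M u⟩ ≤ ‖M‖ ‖u‖₂²`. [folklore] -/
theorem re_star_dotProduct_mulVec_le (M : Matrix m m ℂ) (u : m → ℂ) :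
    (star u ⬝ᵥ (M *ᵥ u)).re ≤ ‖M‖ * eucNorm u ^ 2 := by
  have h1 := Complex.re_le_norm (star u ⬝ᵥ (M *ᵥ u))
  have h2 := norm_star_dotProduct_le u (M *ᵥ u)
  have h3 := eucNorm_mulVec_le M u
  have h4 := eucNorm_nonneg u
  nlinarith [mul_le_mul_of_nonneg_left h3 h4]

open scoped MatrixOrder in
/-- A Hermitian matrix minus its ground energy is a Gram matrix `Bᴴ B`. [folklore] -/
theorem exists_sub_groundEnergy_eq_conjTranspose_mul {H : Matrix m m ℂ} (hH : H.IsHermitian) :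
    ∃ B : Matrix m m ℂ, H - algebraMap ℝ (Matrix m m ℂ) H.groundEnergy = Bᴴ * B := by
  obtain ⟨B, hB⟩ :=
    CStarAlgebra.nonneg_iff_eq_star_mul_self.mp (posSemidef_sub_groundEnergy hH).nonneg
  exact ⟨B, hB⟩

/-- The Gram form of `H - E₀`: `⟨u, H v⟩ = ⟨B u, B v⟩ + E₀ ⟨u, v⟩`. [folklore] -/
theorem star_dotProduct_mulVec_eq_gram {H B : Matrix m m ℂ}
    (hB : H - algebraMap ℝ (Matrix m m ℂ) H.groundEnergy = Bᴴ * B) (u v : m → ℂ) :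
    star u ⬝ᵥ (H *ᵥ v) = star (B *ᵥ u) ⬝ᵥ (B *ᵥ v) + (H.groundEnergy : ℂ) * (star u ⬝ᵥ v) := by
  have hH : H = Bᴴ * B + algebraMap ℝ (Matrix m m ℂ) H.groundEnergy := by rw [← hB]; abel
  have hv : H *ᵥ v = Bᴴ *ᵥ (B *ᵥ v) + H.groundEnergy • v := by
    conv_lhs => rw [hH]
    rw [add_mulVec, mulVec_mulVec, Algebra.algebraMap_eq_smul_one, smul_mulVec, one_mulVec]
  rw [hv, dotProduct_add, dotProduct_smul, Complex.real_smul, dotProduct_mulVec, ← star_mulVec]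

/-- **Cross-term bound.** For Hermitian `H` with ground energy `E₀`, a unit vector `Ψ` with
excess energy `e = Re⟨Ψ, HΨ⟩ - E₀` and any vector `χ`:
`Re⟨χ, HΨ⟩ ≤ E₀ Re⟨χ, Ψ⟩ + √(2‖H‖) ‖χ‖₂ √e` (Cauchy–Schwarz for the Gram form of `H - E₀ ≥ 0`
and `‖Bχ‖² = Re⟨χ,Hχ⟩ - E₀‖χ‖² ≤ 2‖H‖ ‖χ‖²`). [folklore] -/
theorem re_cross_le [Nonempty m] {H : Matrix m m ℂ} (hH : H.IsHermitian) {Ψ : m → ℂ}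
    (hΨ : star Ψ ⬝ᵥ Ψ = 1) (χ : m → ℂ) :
    (star χ ⬝ᵥ (H *ᵥ Ψ)).re ≤ H.groundEnergy * (star χ ⬝ᵥ Ψ).re +
      Real.sqrt (2 * ‖H‖) * eucNorm χ *
        Real.sqrt ((star Ψ ⬝ᵥ (H *ᵥ Ψ)).re - H.groundEnergy) := by
  obtain ⟨B, hB⟩ := exists_sub_groundEnergy_eq_conjTranspose_mul hH
  set E₀ := H.groundEnergy with hE₀
  set e := (star Ψ ⬝ᵥ (H *ᵥ Ψ)).re - E₀ with he
  have h2 : eucNorm (B *ᵥ Ψ) ^ 2 = e := by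
    rw [eucNorm_sq, he, star_dotProduct_mulVec_eq_gram hB Ψ Ψ, hΨ, mul_one, Complex.add_re,
      Complex.ofReal_re]
    ring
  have h3 : eucNorm (B *ᵥ χ) ^ 2 ≤ 2 * ‖H‖ * eucNorm χ ^ 2 := by
    have hre : eucNorm (B *ᵥ χ) ^ 2 = (star χ ⬝ᵥ (H *ᵥ χ)).re - E₀ * eucNorm χ ^ 2 := by
      rw [eucNorm_sq, eucNorm_sq, star_dotProduct_mulVec_eq_gram hB χ χ, Complex.add_re,
        Complex.re_ofReal_mul]
      ring
    have hb1 := re_star_dotProduct_mulVec_le H χ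
    have hb2 := neg_norm_le_groundEnergy hH
    rw [← hE₀] at hb2
    nlinarith [sq_nonneg (eucNorm χ)]
  have h4 := norm_star_dotProduct_le (B *ᵥ χ) (B *ᵥ Ψ)
  have h5 : eucNorm (B *ᵥ χ) ≤ Real.sqrt (2 * ‖H‖) * eucNorm χ := by
    rw [← Real.sqrt_sq (eucNorm_nonneg (B *ᵥ χ)), ← Real.sqrt_sq (eucNorm_nonneg χ),
      ← Real.sqrt_mul (by positivity)]
    exact Real.sqrt_le_sqrt h3
  have h6 : eucNorm (B *ᵥ Ψ) = Real.sqrt e := by rw [← h2, Real.sqrt_sq (eucNorm_nonneg _)]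
  have h7 := Complex.re_le_norm (star (B *ᵥ χ) ⬝ᵥ (B *ᵥ Ψ))
  have h8 : eucNorm (B *ᵥ χ) * eucNorm (B *ᵥ Ψ) ≤
      Real.sqrt (2 * ‖H‖) * eucNorm χ * Real.sqrt e := by
    rw [← h6]
    exact mul_le_mul_of_nonneg_right h5 (eucNorm_nonneg _)
  rw [star_dotProduct_mulVec_eq_gram hB χ Ψ, Complex.add_re, Complex.re_ofReal_mul]
  linarith

omit [DecidableEq m] in
/-- `2 Re⟨OΨ, H OΨ⟩ = 2 Re⟨O²Ψ, HΨ⟩ - Re⟨Ψ, [O,[O,H]] Ψ⟩` for Hermitian `O`, `H`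
(the operator identity `2 OHO = O²H + HO² - [O,[O,H]]`). [cite: KomaTasaki1994, Theorem 2.2] -/
theorem two_mul_re_sandwich_eq {H O : Matrix m m ℂ} (hH : H.IsHermitian) (hO : O.IsHermitian)
    (Ψ : m → ℂ) :
    2 * (star (O *ᵥ Ψ) ⬝ᵥ (H *ᵥ (O *ᵥ Ψ))).re =
      2 * (star (O *ᵥ (O *ᵥ Ψ)) ⬝ᵥ (H *ᵥ Ψ)).re -
        (star Ψ ⬝ᵥ ((O * (O * H - H * O) - (O * H - H * O) * O) *ᵥ Ψ)).re := by
  have hL : star (O *ᵥ Ψ) ⬝ᵥ (H *ᵥ (O *ᵥ Ψ)) = star Ψ ⬝ᵥ ((O * H * O) *ᵥ Ψ) := by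
    rw [mulVec_mulVec, star_mulVec_dotProduct_mulVec, hO.eq, ← mul_assoc]
  have hD : O * (O * H - H * O) - (O * H - H * O) * O =
      O * O * H + H * (O * O) - O * H * O - O * H * O := by noncomm_ring
  have hA : star Ψ ⬝ᵥ ((O * O * H) *ᵥ Ψ) = star (O *ᵥ (O *ᵥ Ψ)) ⬝ᵥ (H *ᵥ Ψ) := by
    rw [mulVec_mulVec, star_mulVec_dotProduct_mulVec, conjTranspose_mul, hO.eq]
  have hB : star Ψ ⬝ᵥ ((H * (O * O)) *ᵥ Ψ) = star (star (O *ᵥ (O *ᵥ Ψ)) ⬝ᵥ (H *ᵥ Ψ)) := by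
    rw [← mulVec_mulVec, star_dotProduct_mulVec_of_isHermitian hH, mulVec_mulVec,
      ← star_dotProduct_star, star_star]
  rw [hL, hD, sub_mulVec, sub_mulVec, add_mulVec, dotProduct_sub, dotProduct_sub, dotProduct_add,
    hA, hB, Complex.sub_re, Complex.sub_re, Complex.add_re, Complex.star_def, Complex.conj_re]
  ring

end WcbcsTrialState

/-! ### The abstract trial-state bound (registered sub-goal) -/

open WcbcsTrialState in
/-- **Abstract Koma–Tasaki trial-state bound** (registered sub-goal of stub S1c). For Hermitian
`H`, `O`, a unit vector `Ψ` with the selection rules `⟨Ψ, OΨ⟩ = ⟨HΨ, OΨ⟩ = ⟨OΨ, O²Ψ⟩ = 0` and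
`‖OΨ‖² ≥ s² > 0`, the trial vector `Ξ = Ψ + OΨ/‖OΨ‖` (`‖Ξ‖² = 2`, `⟨Ξ, OΞ⟩ = 2‖OΨ‖`,
`⟨Ξ, HΞ⟩ = ⟨Ψ, HΨ⟩ + ⟨OΨ, HOΨ⟩/‖OΨ‖²`) gives, for every `h ≥ 0`,
`E₀(H - hO) ≤ E₀ + e/2 + √(2‖H‖)‖O‖√e/(2s) + ‖[O,[O,H]]‖/(4s²) - hs`, `e = Re⟨Ψ,HΨ⟩ - E₀(H)`.
[cite: KomaTasaki1994, Theorem 2.2] -/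
theorem stub_wcbcsTrialStateAbstract :
    ∀ {m : Type} [Fintype m] [DecidableEq m] [Nonempty m] {H O : Matrix m m ℂ}, H.IsHermitian →
      O.IsHermitian → ∀ {Ψ : m → ℂ}, star Ψ ⬝ᵥ Ψ = 1 → star Ψ ⬝ᵥ (O *ᵥ Ψ) = 0 →
      star (H *ᵥ Ψ) ⬝ᵥ (O *ᵥ Ψ) = 0 → star (O *ᵥ Ψ) ⬝ᵥ (O *ᵥ (O *ᵥ Ψ)) = 0 →
      ∀ {s h : ℝ}, 0 < s → 0 ≤ h → s ^ 2 ≤ (star Ψ ⬝ᵥ ((O * O) *ᵥ Ψ)).re →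
      (H - (h : ℂ) • O).groundEnergy ≤
        H.groundEnergy + ((star Ψ ⬝ᵥ (H *ᵥ Ψ)).re - H.groundEnergy) / 2 +
          Real.sqrt (2 * ‖H‖) * ‖O‖ * Real.sqrt ((star Ψ ⬝ᵥ (H *ᵥ Ψ)).re - H.groundEnergy) /
            (2 * s) +
          ‖O * (O * H - H * O) - (O * H - H * O) * O‖ / (4 * s ^ 2) - h * s := by
  intro m _ _ _ H O hH hO Ψ hΨ hV1 hV2 hV3 s h hs hh hsq
  set Φ := O *ᵥ Ψ with hΦ
  set E₀ := H.groundEnergy with hE₀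
  set e := (star Ψ ⬝ᵥ (H *ᵥ Ψ)).re - E₀ with he
  set D := O * (O * H - H * O) - (O * H - H * O) * O with hD
  -- `q = ‖Φ‖² ≥ s²`
  set q : ℝ := eucNorm Φ ^ 2 with hq
  have hΦΦ : star Φ ⬝ᵥ Φ = (q : ℂ) := star_dotProduct_self_eq_eucNorm_sq Φ
  have hOO : star Ψ ⬝ᵥ ((O * O) *ᵥ Ψ) = star Φ ⬝ᵥ Φ := by
    rw [hΦ, star_mulVec_dotProduct_mulVec, hO.eq]
  have hq_ge : s ^ 2 ≤ q := by
    rw [hOO, hΦΦ, Complex.ofReal_re] at hsq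
    exact hsq
  have hq_pos : 0 < q := lt_of_lt_of_le (by positivity) hq_ge
  have hsqrt_q : Real.sqrt q = eucNorm Φ := by rw [hq, Real.sqrt_sq (eucNorm_nonneg _)]
  have hs_le : s ≤ Real.sqrt q := by
    have := Real.sqrt_le_sqrt hq_ge
    rwa [Real.sqrt_sq hs.le] at this
  -- the selection rules in the form used below
  have hΦΨ : star Φ ⬝ᵥ Ψ = 0 := by
    rw [hΦ, ← star_dotProduct_mulVec_of_isHermitian hO]
    exact hV1
  have hΨOΦ : star Ψ ⬝ᵥ (O *ᵥ Φ) = (q : ℂ) := by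
    rw [star_dotProduct_mulVec_of_isHermitian hO, ← hΦ, hΦΦ]
  have hΦOΨ : star Φ ⬝ᵥ (O *ᵥ Ψ) = (q : ℂ) := by rw [← hΦ, hΦΦ]
  have hΨHΦ : star Ψ ⬝ᵥ (H *ᵥ Φ) = 0 := by
    rw [star_dotProduct_mulVec_of_isHermitian hH]
    exact hV2
  have hΦHΨ : star Φ ⬝ᵥ (H *ᵥ Ψ) = 0 := by
    have h0 := congrArg star hV2
    rwa [← star_dotProduct_star, star_star, star_zero] at h0
  -- the trial vector `Ξ = Ψ + c Φ`, `c = 1/√q`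
  set c : ℝ := 1 / Real.sqrt q with hc
  have hcq : c * q = Real.sqrt q := by
    rw [hc]
    field_simp
    rw [Real.sq_sqrt hq_pos.le]
  have hc2q : c ^ 2 * q = 1 := by
    rw [hc]
    field_simp
    rw [Real.sq_sqrt hq_pos.le]
  have hc2r : c ^ 2 * Real.sqrt q = c := by
    rw [hc]
    field_simp
  set Ξ := Ψ + (c : ℂ) • Φ with hΞ
  have hΞΞ : (star Ξ ⬝ᵥ Ξ).re = 2 := by
    have h1 := star_dotProduct_mulVec_add_smul 1 Ψ Φ c
    simp only [one_mulVec] at h1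
    rw [hΞ, h1, hΨ, hV1, hΦΨ, hΦΦ]
    simp only [mul_zero, add_zero, Complex.add_re, Complex.one_re]
    rw [← Complex.ofReal_pow, ← Complex.ofReal_mul, Complex.ofReal_re, hc2q]
    norm_num
  have hΞOΞ : (star Ξ ⬝ᵥ (O *ᵥ Ξ)).re = 2 * Real.sqrt q := by
    rw [hΞ, star_dotProduct_mulVec_add_smul O Ψ Φ c, hV1, hΨOΦ, hΦOΨ, hV3, mul_zero, add_zero,
      zero_add, ← Complex.ofReal_mul, ← Complex.ofReal_add, Complex.ofReal_re, hcq]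
    ring
  have hΞHΞ : (star Ξ ⬝ᵥ (H *ᵥ Ξ)).re =
      (star Ψ ⬝ᵥ (H *ᵥ Ψ)).re + c ^ 2 * (star Φ ⬝ᵥ (H *ᵥ Φ)).re := by
    rw [hΞ, star_dotProduct_mulVec_add_smul H Ψ Φ c, hΨHΦ, hΦHΨ, mul_zero, add_zero, add_zero,
      Complex.add_re, ← Complex.ofReal_pow, Complex.re_ofReal_mul]
  -- variational principle for `K = H - hO`
  have hvar := groundEnergy_mul_le_re (isHermitian_sub_real_smul hH hO h) Ξ
  have hKΞ : (star Ξ ⬝ᵥ ((H - (h : ℂ) • O) *ᵥ Ξ)).re =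
      (star Ξ ⬝ᵥ (H *ᵥ Ξ)).re - h * (star Ξ ⬝ᵥ (O *ᵥ Ξ)).re := by
    rw [sub_mulVec, smul_mulVec, dotProduct_sub, dotProduct_smul, smul_eq_mul, Complex.sub_re,
      Complex.re_ofReal_mul]
  rw [hKΞ, hΞΞ, hΞOΞ, hΞHΞ] at hvar
  -- `Re⟨Φ, HΦ⟩ ≤ E₀ q + T √q + ‖D‖/2`, `T = √(2‖H‖) ‖O‖ √e`
  have hsand := two_mul_re_sandwich_eq hH hO Ψ
  rw [← hΦ, ← hD] at hsand
  have hcross := re_cross_le hH hΨ (O *ᵥ Φ)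
  have hχΨ : (star (O *ᵥ Φ) ⬝ᵥ Ψ).re = q := by
    rw [← star_dotProduct_mulVec_of_isHermitian hO, hΦOΨ, Complex.ofReal_re]
  rw [← hE₀, ← he, hχΨ] at hcross
  have hχ : eucNorm (O *ᵥ Φ) ≤ ‖O‖ * Real.sqrt q := by
    rw [hsqrt_q]
    exact eucNorm_mulVec_le O Φ
  have hDv : -(star Ψ ⬝ᵥ (D *ᵥ Ψ)).re ≤ ‖D‖ := by
    have h1 := re_star_dotProduct_mulVec_le (-D) Ψ
    rwa [neg_mulVec, dotProduct_neg, Complex.neg_re, norm_neg, eucNorm_eq_one hΨ, one_pow,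
      mul_one] at h1
  set T := Real.sqrt (2 * ‖H‖) * ‖O‖ * Real.sqrt e with hT
  have hT0 : 0 ≤ Real.sqrt (2 * ‖H‖) * Real.sqrt e := by positivity
  have hP : (star Φ ⬝ᵥ (H *ᵥ Φ)).re ≤ E₀ * q + T * Real.sqrt q + ‖D‖ / 2 := by
    have h1 : Real.sqrt (2 * ‖H‖) * eucNorm (O *ᵥ Φ) * Real.sqrt e ≤ T * Real.sqrt q := by
      have := mul_le_mul_of_nonneg_left hχ hT0
      rw [hT]
      linarith [this]
    linarith [hsand, hcross, hDv, h1]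
  -- assemble: `2 E₀(H - hO) ≤ (E₀ + e) + c² Re⟨Φ,HΦ⟩ - 2h√q`
  have hstep : c ^ 2 * (star Φ ⬝ᵥ (H *ᵥ Φ)).re ≤ E₀ + T * c + ‖D‖ * c ^ 2 / 2 := by
    have h1 := mul_le_mul_of_nonneg_left hP (sq_nonneg c)
    have h2 : c ^ 2 * (E₀ * q + T * Real.sqrt q + ‖D‖ / 2) =
        E₀ * (c ^ 2 * q) + T * (c ^ 2 * Real.sqrt q) + ‖D‖ * c ^ 2 / 2 := by ring
    rwa [h2, hc2q, hc2r, mul_one] at h1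
  have hTc : T * c ≤ T / s := by
    rw [div_eq_mul_one_div]
    refine mul_le_mul_of_nonneg_left ?_ (by rw [hT]; positivity)
    rw [hc]
    exact one_div_le_one_div_of_le hs hs_le
  have hDc : ‖D‖ * c ^ 2 / 2 ≤ ‖D‖ / (2 * s ^ 2) := by
    have h1 : c ^ 2 ≤ 1 / s ^ 2 := by
      rw [hc, _root_.one_div_pow, Real.sq_sqrt hq_pos.le]
      exact one_div_le_one_div_of_le (by positivity) hq_ge
    have h2 := mul_le_mul_of_nonneg_left h1 (norm_nonneg D)
    rw [mul_one_div] at h2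
    have h3 : ‖D‖ / (2 * s ^ 2) = ‖D‖ / s ^ 2 / 2 := by ring
    rw [h3]
    linarith
  have hhs : h * s ≤ h * Real.sqrt q := mul_le_mul_of_nonneg_left hs_le hh
  have hfin : (H - (h : ℂ) • O).groundEnergy ≤
      E₀ + e / 2 + T / (2 * s) + ‖D‖ / (4 * s ^ 2) - h * s := by
    have h1 : T / (2 * s) = T / s / 2 := by ring
    have h2 : ‖D‖ / (4 * s ^ 2) = ‖D‖ / (2 * s ^ 2) / 2 := by ring
    rw [h1, h2]
    linarith [hvar, hstep, hTc, hDc, hhs]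
  rwa [hT] at hfin

end Summit.HubbardSuperconductivity.HubbardSuperconductivity.Theorems
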